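import Summits.MatrixMultiplication.OmegaCensus.STPPKill223332332Z46AP2

/-!
# ω-census (abelian STPP census): `{(2,2,3),(3,3,2),(3,3,2)}` in `ℤ/46ℤ`, all-progression branch — integer bookkeeping lemmas (kernel)

HONEST FRAMING (pub-omega census; verbatim): lottery ticket; floor = certified bounds/negative ranges.
Census STRUCTURE (seat pub-omega-stpp-2 gen 32, 2026-08-30), family (b2); arithmetic for the last step of BRANCH I (HOME `pub-omega-stpp-2-g32/CASEMAP.md` §6).
For `δ ∈ ℤ/46ℤ` with `2δ ≠ 0` (order `23` or `46`): `n•δ = 0 ⇒ 23 ∣ n` (`dvd23_of_nsmul_eq_zero`) and `m•δ = n•δ ⇒ m = n ∨ m = n ± 23` for `m, n < 40`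
(`nsmul_eq_nsmul_40`) — kernel decisions; hence the pure-integer forms of the two finishing facts: `mult_cases` (`d = ±vδ`, `δ = ±kd`, `v ∈ [1,6] ∪ {11}`,
`k ∈ [3,9]` ⇒ `(v,k) ∈ {(5,9),(3,8),(4,6),(6,4)}`) and `window_dead` (for `u ≠ v` in `[3,6]` the `3 × 3` grid of offsets `±ju ∓ iv` never fits in `13` consecutive
indices, even allowing a wrap by `23`).  Nothing here is progress on `ω`.
-/

namespace Summit.MatrixMultiplication.OmegaCensus.Z46

set_option synthInstance.maxHeartbeats 400000 in
set_option synthInstance.maxSize 4096 in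
/-- `n•δ = 0` with `n < 150` and `2δ ≠ 0` forces `23 ∣ n` (kernel decision). [folklore] -/
theorem dvd23_of_nsmul_eq_zero : ∀ δ : ZMod 46, 2 • δ ≠ 0 → ∀ n < 150, n • δ = 0 → 23 ∣ n := by
  set_option maxRecDepth 100000 in decide +kernel

set_option synthInstance.maxHeartbeats 400000 in
set_option synthInstance.maxSize 4096 in
/-- `m•δ = n•δ` with `m, n < 40` and `2δ ≠ 0` forces `m = n` or `m = n ± 23` (kernel decision). [folklore] -/
theorem nsmul_eq_nsmul_40 : ∀ δ : ZMod 46, 2 • δ ≠ 0 → ∀ m < 40, ∀ n < 40, m • δ = n • δ → (m = n ∨ m = n + 23 ∨ n = m + 23) := by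
  set_option maxRecDepth 100000 in decide +kernel

set_option synthInstance.maxHeartbeats 400000 in
set_option synthInstance.maxSize 4096 in
/-- The integer form of the multiple bookkeeping: `23 ∣ vk − 1` or `23 ∣ vk + 1` with `v ∈ [1,6] ∪ {11}`, `k ∈ [3,9]` forces `(v,k) ∈ {(5,9),(3,8),(4,6),(6,4)}`
(kernel decision). [folklore] -/
theorem mult_cases_int : ∀ v < 12, (1 ≤ v ∧ (v ≤ 6 ∨ v = 11)) → ∀ k < 10, 3 ≤ k → (23 ∣ (v * k - 1) ∨ 23 ∣ (v * k + 1)) →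
    (v = 5 ∧ k = 9) ∨ (v = 3 ∧ k = 8) ∨ (v = 4 ∧ k = 6) ∨ (v = 6 ∧ k = 4) := by
  decide

/-- **Multiple bookkeeping:** `d = ±v•δ` and `δ = ±k•d` (`2d ≠ 0`, `v ∈ [1,6] ∪ {11}`, `3 ≤ k ≤ 9`) force `(v,k) ∈ {(5,9),(3,8),(4,6),(6,4)}`. [folklore] -/
theorem mult_cases {d δ : ZMod 46} (hd : 2 • d ≠ 0) {v k : ℕ} (hv1 : 1 ≤ v) (hv : v ≤ 6 ∨ v = 11) (hk3 : 3 ≤ k) (hk9 : k ≤ 9)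
    (h1 : d = v • δ ∨ d = -(v • δ)) (h2 : δ = k • d ∨ δ = -(k • d)) :
    (v = 5 ∧ k = 9) ∨ (v = 3 ∧ k = 8) ∨ (v = 4 ∧ k = 6) ∨ (v = 6 ∧ k = 4) := by
  apply mult_cases_int v (by omega) ⟨hv1, hv⟩ k (by omega) hk3
  have hvk99 : v * k ≤ 99 := le_trans (Nat.mul_le_mul (by omega : v ≤ 11) hk9) (by norm_num)
  have hvk1 : 1 ≤ v * k := Nat.one_le_iff_ne_zero.2 (Nat.mul_ne_zero (by omega) (by omega))
  -- `d = ±(v k)•d`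
  have hvk : d = (v * k) • d ∨ d = -((v * k) • d) := by
    rcases h1 with h1 | h1 <;> rcases h2 with h2 | h2 <;> rw [h2] at h1
    · left; rwa [← mul_nsmul'] at h1
    · right; rwa [neg_nsmul, ← mul_nsmul'] at h1
    · right; rwa [← mul_nsmul'] at h1
    · left; rwa [neg_nsmul, neg_neg, ← mul_nsmul'] at h1
  rcases hvk with h | h
  · left
    apply dvd23_of_nsmul_eq_zero d hd (v * k - 1) (by omega)
    have e1 : (v * k - 1) • d + d = (v * k) • d := by rw [← succ_nsmul, Nat.sub_add_cancel hvk1]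
    have e : (v * k - 1) • d = (v * k) • d - d := by rw [← e1]; abel
    rw [e, ← h, sub_self]
  · right
    apply dvd23_of_nsmul_eq_zero d hd (v * k + 1) (by omega)
    have e : (v * k) • d = -d := by
      have := congrArg Neg.neg h
      rw [neg_neg] at this
      exact this.symm
    rw [succ_nsmul, e, neg_add_cancel]

set_option synthInstance.maxHeartbeats 400000 in
set_option synthInstance.maxSize 4096 in
/-- **Window bookkeeping (integer form).**  Offsets `w = ±(j u) ∓ (i v)` of the `3 × 3` grid are moved across `l•δ − l₀•δ = w•δ` to natural-number sides
`L = l + [i v]_{−} + [j u]_{+…}`; for `u ≠ v` in `[3,6]` there is no `l₀ < 13` such that every grid offset admits an index `l < 13` with `L = R`, `L = R + 23` or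
`R = L + 23` (kernel decision over integers; the `± 23` covers steps of order `23`). [folklore] -/
theorem window_dead_int : ∀ l₀ < 13, ∀ u < 7, 3 ≤ u → ∀ v < 7, 3 ≤ v → u ≠ v → ∀ su : Bool, ∀ sv : Bool,
    ¬ (∀ i < 3, ∀ j < 3, ∃ l < 13,
      (l + (if sv then 0 else i * v) + (if su then j * u else 0) = l₀ + (if su then 0 else j * u) + (if sv then i * v else 0) ∨
       l + (if sv then 0 else i * v) + (if su then j * u else 0) = l₀ + (if su then 0 else j * u) + (if sv then i * v else 0) + 23 ∨
       l₀ + (if su then 0 else j * u) + (if sv then i * v else 0) = l + (if sv then 0 else i * v) + (if su then j * u else 0) + 23)) := by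
  decide

end Summit.MatrixMultiplication.OmegaCensus.Z46
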